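import Summits.CriticalPhenomena.PercolationContinuityZ3.Theorems.PercNearOneGluingNoHeavyLowerTailNineTypeRadical

/-!
# Nine-type programme for `Q44b`: PHO — the half-sum of a PURE dependency is orthogonal to every H-row

Support file for crux `stmt-CriticalPhenomena-4575` (master-family programme, quadratic four-point row `Q44b`,
GF(2)-rank line of `prim-bnk-1` gen 16–19), seat `prim-bnk-1` gen 19; memo
`run/shared/lean/prim/prim-l12/FROM-prim-bnk-1-gen19-HALL-GRAM-ASSEMBLY.md` §7–§8.

THEOREM (PHO, `NineType.pure_halfsum_orthogonal`).  Let `𝒯` be a typed COV configuration with goods `𝔊` (an up-set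
containing the HL- and HH-forced unions), and let `Y ⊆ 𝒯` (free points, types 5/7) and `A ⊆ 𝒯` (anchors, types
8/9) form an H-dependency: every good contains as many members of `Y` as of `A` modulo 2.  Then for every
`s ∈ 𝒯` the HALF-SUM detector `u ↦ #{y ∈ Y : y ⊆ u} (mod 2)` is orthogonal to the H-row of `s`:
`Σ_{u ∈ 𝔊, s ⊆ u} #{y ∈ Y : y ⊆ u} ≡ 0 (mod 2)`.

PROOF (memo §8).  On a good `u`, `#{y ⊆ u} ≡ #{a ⊆ u}`, hence `#{y ⊆ u} ≡ #{y ⊆ u}·#{a ⊆ u} = #{(y,a) : y ∪ a ⊆ u}`;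
every `y ∪ a` is HH-good, so summing over the goods above `s` gives `#{(y,a) : y ∪ a ∪ s = univ}` (toggling lemma).
If `θ s ≤ 7`: a covering pair forces `s ∪ a ⊇ s ∪ yᶜ ∈ 𝔊`, and then the FLIPPED dependency at the good `s ∪ a` turns
`#{y : y ∪ a ∪ s = univ}` into `#{a' : a' ∪ a ∪ s = univ}`; the resulting relation on `A` is symmetric with empty
diagonal (COV), so the count is even.  If `θ s ∈ {8,9}` the same argument runs with the roles of `Y` and `A` exchanged.

COROLLARIES.  `NineType.pure_top_L_row_not_H_combination'` — for the top `t` (free, of maximal cardinality among the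
free members) of ANY pure H-dependency, the L-row of `t` is not a GF(2)-combination of H-rows (all five circuit
lemmas of gen 18 — twins, rectangles, forks, dual forks, joins — are special cases, with one uniform certificate);
`NineType.pure_corank_one_card_le'` — if moreover every H-dependency passes through `t`, then `#𝒯 ≤ #𝔊`.

Pure finite combinatorics; no named facts, no sorries, standard axioms.
-/

namespace Summit.CriticalPhenomena.PercolationContinuityZ3.Theorems

namespace NineType

open Finset

variable {α : Type*} [DecidableEq α] [Fintype α]

/-- In `ZMod 2` every element is idempotent. -/
theorem zmod2_mul_self (x : ZMod 2) : x * x = x := by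
  fin_cases x <;> rfl

/-- In `ZMod 2`, `x + y = 0` forces `x = y`. -/
theorem zmod2_eq_of_add_eq_zero (x y : ZMod 2) (h : x + y = 0) : x = y := by
  fin_cases x <;> fin_cases y <;> first | rfl | exact absurd h (by decide)

omit [Fintype α] in
/-- Splitting a filter count over a disjoint union, in `ZMod 2`. -/
theorem card_filter_union_cast (Y A : Finset (Finset α)) (hYA : Disjoint Y A) (p : Finset α → Prop)
    [DecidablePred p] :
    ((#((Y ∪ A).filter p) : ℕ) : ZMod 2) = ((#(Y.filter p) : ℕ) : ZMod 2) + ((#(A.filter p) : ℕ) : ZMod 2) := by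
  rw [card_filter_union_of_disjoint Y A hYA p]; push_cast; rfl

/-- `p ∪ q ∪ s = univ ↔ pᶜ ⊆ s ∪ q`. -/
theorem union3_eq_univ_iff (p q s : Finset α) : p ∪ q ∪ s = univ ↔ pᶜ ⊆ s ∪ q := by
  rw [← union_eq_univ_iff_compl_subset (s ∪ q) p]
  constructor
  · intro h; rw [← h]; ext x; simp only [Finset.mem_union]; tauto
  · intro h; rw [← h]; ext x; simp only [Finset.mem_union]; tauto

/-- **Core double count.**  Families `P, Q`, a set `s` and an up-set `𝔊` such that: the flipped dependency
`#{p ∈ P : pᶜ ⊆ g} ≡ #{q ∈ Q : qᶜ ⊆ g}` holds on every good `g`; `s ∪ pᶜ ∈ 𝔊` for `p ∈ P`; `q ∪ q'ᶜ ∈ 𝔊` for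
`q, q' ∈ Q`; and no `q ∈ Q` covers `univ` together with `s`.  Then `#{(p,q) ∈ P × Q : p ∪ q ∪ s = univ}` is even.
[this work] -/
theorem cover_parity_core (𝔊 : Finset (Finset α))
    (hG : ∀ g ∈ 𝔊, ∀ g' : Finset α, g ⊆ g' → g' ∈ 𝔊)
    (P Q : Finset (Finset α)) (s : Finset α)
    (hflip : ∀ g ∈ 𝔊, ((#(P.filter (fun p => pᶜ ⊆ g)) : ℕ) : ZMod 2) = ((#(Q.filter (fun q => qᶜ ⊆ g)) : ℕ) : ZMod 2))
    (hP : ∀ p ∈ P, s ∪ pᶜ ∈ 𝔊) (hQQ : ∀ q ∈ Q, ∀ q' ∈ Q, q ∪ q'ᶜ ∈ 𝔊) (hcovQ : ∀ q ∈ Q, q ∪ s ≠ univ) :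
    (∑ p ∈ P, ∑ q ∈ Q, (if p ∪ q ∪ s = univ then (1 : ZMod 2) else 0)) = 0 := by
  rw [Finset.sum_comm]
  -- for each q: the inner sum over P equals the corresponding sum over Q
  have hinner : ∀ q ∈ Q, (∑ p ∈ P, (if p ∪ q ∪ s = univ then (1 : ZMod 2) else 0))
      = ∑ q' ∈ Q, (if q' ∪ q ∪ s = univ then (1 : ZMod 2) else 0) := by
    intro q hq
    by_cases hgood : s ∪ q ∈ 𝔊
    · have hf := hflip (s ∪ q) hgood
      rw [card_filter_cast, card_filter_cast] at hf
      have hl : (∑ p ∈ P, (if p ∪ q ∪ s = univ then (1 : ZMod 2) else 0))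
          = ∑ p ∈ P, (if pᶜ ⊆ s ∪ q then (1 : ZMod 2) else 0) := by
        refine Finset.sum_congr rfl fun p _ => ?_
        by_cases h : p ∪ q ∪ s = univ
        · rw [if_pos h, if_pos ((union3_eq_univ_iff p q s).1 h)]
        · rw [if_neg h, if_neg (fun h' => h ((union3_eq_univ_iff p q s).2 h'))]
      have hr : (∑ q' ∈ Q, (if q' ∪ q ∪ s = univ then (1 : ZMod 2) else 0))
          = ∑ q' ∈ Q, (if q'ᶜ ⊆ s ∪ q then (1 : ZMod 2) else 0) := by
        refine Finset.sum_congr rfl fun q' _ => ?_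
        by_cases h : q' ∪ q ∪ s = univ
        · rw [if_pos h, if_pos ((union3_eq_univ_iff q' q s).1 h)]
        · rw [if_neg h, if_neg (fun h' => h ((union3_eq_univ_iff q' q s).2 h'))]
      rw [hl, hr]; exact hf
    · -- both sums vanish termwise: a covering partner would make `s ∪ q` good
      have hl : (∑ p ∈ P, (if p ∪ q ∪ s = univ then (1 : ZMod 2) else 0)) = 0 := by
        refine Finset.sum_eq_zero fun p hp => ?_
        rw [if_neg]
        intro hcov
        apply hgood
        have hsub : s ∪ pᶜ ⊆ s ∪ q :=
          Finset.union_subset subset_union_left ((union3_eq_univ_iff p q s).1 hcov)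
        exact hG _ (hP p hp) _ hsub
      have hr : (∑ q' ∈ Q, (if q' ∪ q ∪ s = univ then (1 : ZMod 2) else 0)) = 0 := by
        refine Finset.sum_eq_zero fun q' hq' => ?_
        rw [if_neg]
        intro hcov
        apply hgood
        have hsub : q ∪ q'ᶜ ⊆ s ∪ q :=
          Finset.union_subset subset_union_right ((union3_eq_univ_iff q' q s).1 hcov)
        exact hG _ (hQQ q hq q' hq') _ hsub
      rw [hl, hr]
  rw [Finset.sum_congr rfl hinner]
  -- now a symmetric double count over Q with empty diagonal
  have hsym := sum_card_filter_symm Q (fun q' q => q' ∪ q ∪ s = univ) (by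
    intro b _ b' _ h
    rw [← h]; ext x; simp only [Finset.mem_union]; tauto)
  have hrw : (∑ q ∈ Q, ∑ q' ∈ Q, (if q' ∪ q ∪ s = univ then (1 : ZMod 2) else 0))
      = ∑ q ∈ Q, ((#(Q.filter (fun q' => q' ∪ q ∪ s = univ)) : ℕ) : ZMod 2) := by
    refine Finset.sum_congr rfl fun q _ => ?_
    rw [card_filter_cast]
  rw [hrw, hsym]
  have hempty : Q.filter (fun q => q ∪ q ∪ s = univ) = ∅ := by
    refine Finset.filter_eq_empty_iff.2 fun q hq h => ?_
    rw [Finset.union_idempotent] at h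
    exact hcovQ q hq h
  rw [hempty, Finset.card_empty, Nat.cast_zero]

/-- Table facts used by PHO. -/
theorem hlOK_low_free (x y : ℕ) (hx : 1 ≤ x ∧ x ≤ 7) (hy : y = 5 ∨ y = 7) : hlOK x y = true := by
  rcases hx with ⟨h1, h7⟩
  interval_cases x <;> rcases hy with rfl | rfl <;> decide

/-- Table fact: anchors are pairwise HL-compatible. -/
theorem hlOK_anchor (x y : ℕ) (hx : x = 8 ∨ x = 9) (hy : y = 8 ∨ y = 9) : hlOK x y = true := by
  rcases hx with rfl | rfl <;> rcases hy with rfl | rfl <;> decide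

/-- Table fact: free and anchor types are HH-compatible. -/
theorem hhOK_free_anchor (x y : ℕ) (hx : x = 5 ∨ x = 7) (hy : y = 8 ∨ y = 9) : hhOK x y = true := by
  rcases hx with rfl | rfl <;> rcases hy with rfl | rfl <;> decide

/-- **PHO (pure half-dependency orthogonality).**  See the module docstring. [this work] -/
theorem pure_halfsum_orthogonal (𝒯 : Finset (Finset α)) (θ : Finset α → ℕ)
    (hθ : ∀ s ∈ 𝒯, 1 ≤ θ s ∧ θ s ≤ 9)
    (hcov : ∀ s ∈ 𝒯, ∀ s' ∈ 𝒯, s ≠ s' → s ∪ s' ≠ univ)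
    (𝔊 : Finset (Finset α)) (hG : ∀ g ∈ 𝔊, ∀ g' : Finset α, g ⊆ g' → g' ∈ 𝔊)
    (hHL : ∀ s ∈ 𝒯, ∀ s' ∈ 𝒯, hlOK (θ s) (θ s') = true → s ∪ s'ᶜ ∈ 𝔊)
    (hHH : ∀ s ∈ 𝒯, ∀ s' ∈ 𝒯, s ≠ s' → hhOK (θ s) (θ s') = true → s ∪ s' ∈ 𝔊)
    (Y A : Finset (Finset α)) (hY : Y ⊆ 𝒯) (hA : A ⊆ 𝒯)
    (hYt : ∀ y ∈ Y, θ y = 5 ∨ θ y = 7) (hAt : ∀ a ∈ A, θ a = 8 ∨ θ a = 9)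
    (hdep : ∀ g ∈ 𝔊, ((#(Y.filter (fun y => y ⊆ g)) : ℕ) : ZMod 2) = ((#(A.filter (fun a => a ⊆ g)) : ℕ) : ZMod 2)) :
    ∀ s ∈ 𝒯, (∑ u ∈ 𝔊.filter (fun u => s ⊆ u), ((#(Y.filter (fun y => y ⊆ u)) : ℕ) : ZMod 2)) = 0 := by
  intro s hs
  -- members of Y and A are distinct (types), in particular Y and A are disjoint
  have hne : ∀ y ∈ Y, ∀ a ∈ A, y ≠ a := by
    intro y hy a ha h
    rcases hYt y hy with h5 | h7 <;> rcases hAt a ha with h8 | h9 <;> rw [h] at * <;> omega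
  have hYA : Disjoint Y A := Finset.disjoint_left.2 fun y hy ha => hne y hy y ha rfl
  have hgoodYA : ∀ y ∈ Y, ∀ a ∈ A, y ∪ a ∈ 𝔊 := fun y hy a ha =>
    hHH y (hY hy) a (hA ha) (hne y hy a ha) (hhOK_free_anchor _ _ (hYt y hy) (hAt a ha))
  -- Step 1: on the goods above s, #{y ⊆ u} ≡ Σ_{(y,a)} [y ∪ a ⊆ u]
  have h1 : (∑ u ∈ 𝔊.filter (fun u => s ⊆ u), ((#(Y.filter (fun y => y ⊆ u)) : ℕ) : ZMod 2))
      = ∑ u ∈ 𝔊.filter (fun u => s ⊆ u), ∑ y ∈ Y, ∑ a ∈ A,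
          (if y ∪ a ⊆ u then (1 : ZMod 2) else 0) := by
    refine Finset.sum_congr rfl fun u hu => ?_
    have hu𝔊 : u ∈ 𝔊 := (Finset.mem_filter.1 hu).1
    rw [← zmod2_mul_self (((#(Y.filter (fun y => y ⊆ u)) : ℕ) : ZMod 2))]
    nth_rewrite 2 [hdep u hu𝔊]
    rw [card_filter_cast, card_filter_cast, Finset.sum_mul]
    refine Finset.sum_congr rfl fun y _ => ?_
    rw [Finset.mul_sum]
    refine Finset.sum_congr rfl fun a _ => ?_
    by_cases hy : y ⊆ u
    · by_cases ha : a ⊆ u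
      · rw [if_pos hy, if_pos ha, if_pos (Finset.union_subset hy ha), one_mul]
      · rw [if_pos hy, if_neg ha, if_neg (fun h => ha (subset_union_right.trans h)), mul_zero]
    · rw [if_neg hy, if_neg (fun h => hy (subset_union_left.trans h)), zero_mul]
  -- Step 2: swap the sums and count the goods above y ∪ a ∪ s: parity [y ∪ a ∪ s = univ]
  have h2 : (∑ u ∈ 𝔊.filter (fun u => s ⊆ u), ∑ y ∈ Y, ∑ a ∈ A,
          (if y ∪ a ⊆ u then (1 : ZMod 2) else 0))
      = ∑ y ∈ Y, ∑ a ∈ A, (if y ∪ a ∪ s = univ then (1 : ZMod 2) else 0) := by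
    rw [Finset.sum_comm]
    refine Finset.sum_congr rfl fun y hy => ?_
    rw [Finset.sum_comm]
    refine Finset.sum_congr rfl fun a ha => ?_
    rw [Finset.sum_filter]
    have hstep : (∑ u ∈ 𝔊, (if s ⊆ u then (if y ∪ a ⊆ u then (1 : ZMod 2) else 0) else 0))
        = ∑ u ∈ 𝔊, (if y ∪ a ∪ s ⊆ u then (1 : ZMod 2) else 0) := by
      refine Finset.sum_congr rfl fun u _ => ?_
      by_cases hsu : s ⊆ u
      · by_cases hyau : y ∪ a ⊆ u
        · rw [if_pos hsu, if_pos hyau, if_pos (Finset.union_subset hyau hsu)]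
        · rw [if_pos hsu, if_neg hyau, if_neg (fun h => hyau (subset_union_left.trans h))]
      · rw [if_neg hsu, if_neg (fun h => hsu (subset_union_right.trans h))]
    rw [hstep, ← card_filter_cast,
      card_supersets_parity 𝔊 hG (y ∪ a ∪ s) (hG _ (hgoodYA y hy a ha) _ subset_union_left)]
  rw [h1, h2]
  -- flipped dependency: #{y : yᶜ ⊆ g} ≡ #{a : aᶜ ⊆ g} on every good g
  have hdep0 : ∀ g ∈ 𝔊, ((#((Y ∪ A).filter (fun ρ => ρ ⊆ g)) : ℕ) : ZMod 2) = 0 := by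
    intro g hg
    rw [card_filter_union_cast Y A hYA, hdep g hg]
    exact CharTwo.add_self_eq_zero _
  have hflipYA : ∀ g ∈ 𝔊, ((#(Y.filter (fun y => yᶜ ⊆ g)) : ℕ) : ZMod 2)
      = ((#(A.filter (fun a => aᶜ ⊆ g)) : ℕ) : ZMod 2) := by
    intro g hg
    have h0 := flip_even 𝔊 hG (Y ∪ A) hdep0 g hg
    rw [card_filter_union_cast Y A hYA] at h0
    exact zmod2_eq_of_add_eq_zero _ _ h0
  -- Step 3: the core double count, oriented by the type of s
  have hθs := hθ s hs
  by_cases hlow : θ s ≤ 7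
  · -- P = Y, Q = A
    refine cover_parity_core 𝔊 hG Y A s hflipYA ?_ ?_ ?_
    · intro y hy
      exact hHL s hs y (hY hy) (hlOK_low_free _ _ ⟨hθs.1, hlow⟩ (hYt y hy))
    · intro a ha a' ha'
      exact hHL a (hA ha) a' (hA ha') (hlOK_anchor _ _ (hAt a ha) (hAt a' ha'))
    · intro a ha
      have hne' : a ≠ s := by
        intro h; rcases hAt a ha with h8 | h9 <;> rw [h] at * <;> omega
      exact hcov a (hA ha) s hs hne'
  · -- θ s ∈ {8,9}: P = A, Q = Y, after swapping the double sum
    have h89 : θ s = 8 ∨ θ s = 9 := by omega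
    rw [Finset.sum_comm]
    have hswap : (∑ a ∈ A, ∑ y ∈ Y, (if y ∪ a ∪ s = univ then (1 : ZMod 2) else 0))
        = ∑ a ∈ A, ∑ y ∈ Y, (if a ∪ y ∪ s = univ then (1 : ZMod 2) else 0) := by
      refine Finset.sum_congr rfl fun a _ => Finset.sum_congr rfl fun y _ => ?_
      rw [Finset.union_comm y a]
    rw [hswap]
    refine cover_parity_core 𝔊 hG A Y s (fun g hg => (hflipYA g hg).symm) ?_ ?_ ?_
    · intro a ha
      exact hHL s hs a (hA ha) (hlOK_anchor _ _ h89 (hAt a ha))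
    · intro y hy y' hy'
      exact hHL y (hY hy) y' (hY hy') (hlOK_free _ _ (hYt y hy) (hYt y' hy'))
    · intro y hy
      have hne' : y ≠ s := by
        intro h; rcases hYt y hy with h5 | h7 <;> rw [h] at * <;> omega
      exact hcov y (hY hy) s hs hne'

/-- **Corollary (K1 for every pure circuit, unconditional).**  In a typed COV configuration with goods `𝔊`
(up-set ⊇ HL/HH-forced unions), let `Y` (free) and `A` (anchors) form an H-dependency and let `t ∈ Y` have maximal
cardinality in `Y`.  Then no `S ⊆ 𝒯` represents the L-row of `t`. [this work] -/
theorem pure_top_L_row_not_H_combination' (𝒯 : Finset (Finset α)) (θ : Finset α → ℕ)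
    (hθ : ∀ s ∈ 𝒯, 1 ≤ θ s ∧ θ s ≤ 9)
    (hcov : ∀ s ∈ 𝒯, ∀ s' ∈ 𝒯, s ≠ s' → s ∪ s' ≠ univ)
    (𝔊 : Finset (Finset α)) (hG : ∀ g ∈ 𝔊, ∀ g' : Finset α, g ⊆ g' → g' ∈ 𝔊)
    (hHL : ∀ s ∈ 𝒯, ∀ s' ∈ 𝒯, hlOK (θ s) (θ s') = true → s ∪ s'ᶜ ∈ 𝔊)
    (hHH : ∀ s ∈ 𝒯, ∀ s' ∈ 𝒯, s ≠ s' → hhOK (θ s) (θ s') = true → s ∪ s' ∈ 𝔊)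
    (Y A : Finset (Finset α)) (hY : Y ⊆ 𝒯) (hA : A ⊆ 𝒯)
    (hYt : ∀ y ∈ Y, θ y = 5 ∨ θ y = 7) (hAt : ∀ a ∈ A, θ a = 8 ∨ θ a = 9)
    (hdep : ∀ g ∈ 𝔊, ((#(Y.filter (fun y => y ⊆ g)) : ℕ) : ZMod 2) = ((#(A.filter (fun a => a ⊆ g)) : ℕ) : ZMod 2))
    (t : Finset α) (ht : t ∈ Y) (htmax : ∀ y ∈ Y, #y ≤ #t)
    (S : Finset (Finset α)) (hS : S ⊆ 𝒯) :
    ¬ (∀ g ∈ 𝔊, ((#(S.filter (fun s => s ⊆ g)) : ℕ) : ZMod 2) = if tᶜ ⊆ g then 1 else 0) :=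
  pure_top_L_row_not_H_combination 𝒯 θ 𝔊 hG hHL Y hY hYt t ht htmax
    (pure_halfsum_orthogonal 𝒯 θ hθ hcov 𝔊 hG hHL hHH Y A hY hA hYt hAt hdep) S hS

/-- **Corollary (count for corank-one configurations with a pure circuit, unconditional).** [this work] -/
theorem pure_corank_one_card_le' (𝒯 : Finset (Finset α)) (θ : Finset α → ℕ)
    (hθ : ∀ s ∈ 𝒯, 1 ≤ θ s ∧ θ s ≤ 9)
    (hcov : ∀ s ∈ 𝒯, ∀ s' ∈ 𝒯, s ≠ s' → s ∪ s' ≠ univ)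
    (𝔊 : Finset (Finset α)) (hG : ∀ g ∈ 𝔊, ∀ g' : Finset α, g ⊆ g' → g' ∈ 𝔊)
    (hHL : ∀ s ∈ 𝒯, ∀ s' ∈ 𝒯, hlOK (θ s) (θ s') = true → s ∪ s'ᶜ ∈ 𝔊)
    (hHH : ∀ s ∈ 𝒯, ∀ s' ∈ 𝒯, s ≠ s' → hhOK (θ s) (θ s') = true → s ∪ s' ∈ 𝔊)
    (Y A : Finset (Finset α)) (hY : Y ⊆ 𝒯) (hA : A ⊆ 𝒯)
    (hYt : ∀ y ∈ Y, θ y = 5 ∨ θ y = 7) (hAt : ∀ a ∈ A, θ a = 8 ∨ θ a = 9)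
    (hdep : ∀ g ∈ 𝔊, ((#(Y.filter (fun y => y ⊆ g)) : ℕ) : ZMod 2) = ((#(A.filter (fun a => a ⊆ g)) : ℕ) : ZMod 2))
    (t : Finset α) (ht : t ∈ Y) (htmax : ∀ y ∈ Y, #y ≤ #t) (htne : tᶜ ≠ t)
    (hdepT : ∀ 𝒮 ⊆ 𝒯, 𝒮.Nonempty → (∀ g ∈ 𝔊, ¬ Odd #(𝒮.filter (fun S => S ⊆ g))) → t ∈ 𝒮) :
    #𝒯 ≤ #𝔊 :=
  pure_corank_one_card_le 𝒯 θ hcov 𝔊 hG hHL Y hY hYt t ht htmax htne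
    (pure_halfsum_orthogonal 𝒯 θ hθ hcov 𝔊 hG hHL hHH Y A hY hA hYt hAt hdep) hdepT

end NineType

end Summit.CriticalPhenomena.PercolationContinuityZ3.Theorems
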